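import Summits.ResolutionOfSingularities.ResolutionOfSingularities.Theorems.WeightedInvariantHypersurfaceCentreAssemblyPlusStalk
import Summits.ResolutionOfSingularities.ResolutionOfSingularities.Theorems.WeightedInvariantDatumToEmbeddedAtlasAmbientChart
import HarnessLib

/-!
# The chart `φ_U : Spec ⊕𝒥ₙ(U)tⁿ ∖ V(⊕_{n>0}) ⟶ B₊`: SECTIONS of `B₊` from elements of the chart algebra

Route `ResolutionOfSingularities/WeightedInvariant`, crux `Theses.WeightedInvariant.HypersurfaceCentreConstruction`
(stmt-ResolutionOfSingularities-19897), door line `local-engine`, E2 tier (S-b2-over) (res-L1-w43-plan-1 SPEC (Δ6b) rev 6, OFFER (o59-b2-over)).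

For the chart `φ = φ_U` of K4-E (`exists_plusChartFac`, …CentreAssemblyPlusStalk: `φ ≫ B₊.ι = ι ≫ (cover map over U)`) every element `z` of the
chart algebra `S = ⊕ 𝒥ₙ(U) tⁿ` IS a section of `B₊` over the image `φ(chart) = σ₊⁻¹ U`:
`ρ := (ΓSpecIso S)⁻¹ ≫ ι^* ≫ (φ.appIso ⊤)⁻¹ : S → Γ(B₊, φ ''ᵁ ⊤)`.  This file records the three facts the `t`-homogeneity clause of
`Stage.SuccOverCentreAt` reads off `ρ` (`exists_plusChartFac_sections`):
* `ρ (a·1) = σ₊.appLE U (φ ''ᵁ ⊤) a` — the structure sections (`plusChartFac_comp_πPlus`, `fromSpec_appLE_top`, `appLE_top_comp_ΓSpecIso_hom`);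
* `ρ t⁻¹ = tInvOn R' (φ ''ᵁ ⊤)` — the exceptional coordinate (`ι_toA1`, `polyToSections_X`);
* `φ^♯_x (germ_{φ x} (ρ z)) = ι^♯_x (toStalk S (ι x) z)` — the germ of `ρ z` read on the chart (`appIso_inv_app`); with
  `…PlusStalkGameSideCoeff` (`φ^♯_x (Ψ⁻¹ ((ℓ z)/1)) = ι^♯_x (toStalk S (ι x) z)`) this says `germ (ρ z) = Ψ⁻¹ ((ℓ z)/1)`.
Plus the restriction forms to an open `W' ≤ φ ''ᵁ ⊤` (`plusChartFac_sections_restrict`).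
Def-free; OURS bookkeeping; nothing here is a claim about Hironaka's problem; AI-written, weaker than expert review.
[cite: Wlodarczyk2022, Def. 5.1.1; 3.3.12]
-/

noncomputable section

set_option linter.dupNamespace false -- mandated namespace of this single-conjunct summit
-- `Γ(B₊, W')` versus `presheaf.obj` inside `rw` motives on the glued scheme `R'.plus` (as in `…ELadderOneSingOffCentre`):
set_option backward.isDefEq.respectTransparency false

open CategoryTheory AlgebraicGeometry TopologicalSpace IsLocalRing
open scoped LaurentPolynomial
open LaurentPolynomial
open Literature.AlgebraicGeometry.Resolution
open Summit.ResolutionOfSingularities.ResolutionOfSingularities.Theorems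

namespace Summit.ResolutionOfSingularities.ResolutionOfSingularities.Cruxes.HypersurfaceCentreConstruction.LocalEngine

section Chart

variable {Y : Scheme.{0}} (R' : ReesFiltration Y) (U : Y.affineOpens)
  (φ : (R'.plusChart U : Scheme.{0}) ⟶ (R'.plus : Scheme.{0}))
  (hφ : φ ≫ R'.plus.ι = (R'.plusChart U).ι ≫ R'.openCover.f ⟨U.1, U.2⟩)

include hφ

/-- The image of the chart lies over `U`. [folklore] -/
theorem image_top_le_of_plusChartFac [IsOpenImmersion φ] :
    φ ''ᵁ ⊤ ≤ R'.πPlus ⁻¹ᵁ (U : Y.Opens) := by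
  rintro _ ⟨x, -, rfl⟩
  exact πPlus_plusChartFac_mem R' U φ hφ x

/-- **`φ ≫ B₊.ι ≫ t⁻¹ = ι ≫ Spec (x ↦ t⁻¹)`** (`R'.ι_toA1`). [cite: Wlodarczyk2022, Def. 2.3.5] -/
theorem plusChartFac_comp_toA1 :
    φ ≫ (R'.plus.ι ≫ R'.toA1) = (R'.plusChart U).ι ≫ Spec.map (CommRingCat.ofHom (R'.polyToSections U)) := by
  rw [← Category.assoc, hφ, Category.assoc]
  exact congrArg (fun ψ => (R'.plusChart U).ι ≫ ψ) (R'.ι_toA1 ⟨U.1, U.2⟩)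

set_option maxHeartbeats 400000 in
/-- The structure sections along the chart, as morphisms: `σ₊.appLE U (φ''⊤) ≫ (φ.appIso ⊤).hom = (A → S) ≫ (ΓSpecIso S)⁻¹ ≫ ι^*`.
[cite: Wlodarczyk2022, Def. 5.1.1] -/
theorem πPlus_appLE_comp_appIso_hom [IsOpenImmersion φ] :
    R'.πPlus.appLE U (φ ''ᵁ ⊤) (image_top_le_of_plusChartFac R' U φ hφ) ≫ (φ.appIso ⊤).hom =
      CommRingCat.ofHom (algebraMap Γ(Y, U) (R'.sectionsRing U)) ≫
        (Scheme.ΓSpecIso (CommRingCat.of (R'.sectionsRing U))).inv ≫ (R'.plusChart U).ι.appLE ⊤ ⊤ le_top := by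
  -- `φ ≫ σ₊ = (ι ≫ Spec (A → S)) ≫ fromSpec`
  have hψ : φ ≫ R'.πPlus = ((R'.plusChart U).ι ≫
      Spec.map (CommRingCat.ofHom (algebraMap Γ(Y, U) (R'.sectionsRing U)))) ≫ U.2.fromSpec := by
    rw [Category.assoc]; exact plusChartFac_comp_πPlus R' U φ hφ
  rw [Scheme.Hom.appIso_hom', Scheme.Hom.appLE_comp_appLE, appLE_congr_hom hψ,
    ← Scheme.Hom.appLE_comp_appLE _ U.2.fromSpec _ ⊤ _ U.2.fromSpec_preimage_self.ge le_top,
    fromSpec_appLE_top, ← Scheme.Hom.appLE_comp_appLE _ _ _ ⊤ _ le_top le_top, ← Category.assoc,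
    ← Category.assoc]
  congr 1
  -- `(ΓSpecIso A)⁻¹ ≫ (Spec (A→S)).appLE ⊤ ⊤ = (A→S) ≫ (ΓSpecIso S)⁻¹`
  rw [Iso.inv_comp_eq, ← Category.assoc, Iso.eq_comp_inv]
  exact DatumToEmbedded.StrictTransform.appLE_top_comp_ΓSpecIso_hom _ _

/-- The exceptional coordinate along the chart, as morphisms: `(B₊.ι ≫ t⁻¹).appLE ⊤ (φ''⊤) ≫ (φ.appIso ⊤).hom =
(ΓSpecIso ℤ[x]).hom ≫ (x ↦ t⁻¹) ≫ (ΓSpecIso S)⁻¹ ≫ ι^*`. [cite: Wlodarczyk2022, Def. 2.3.5] -/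
theorem toA1_appLE_comp_appIso_hom [IsOpenImmersion φ] :
    (R'.plus.ι ≫ R'.toA1).appLE ⊤ (φ ''ᵁ ⊤) le_top ≫ (φ.appIso ⊤).hom =
      (Scheme.ΓSpecIso (CommRingCat.of (Polynomial ReesFiltration.ZZ.{0}))).hom ≫
        CommRingCat.ofHom (R'.polyToSections U) ≫
        (Scheme.ΓSpecIso (CommRingCat.of (R'.sectionsRing U))).inv ≫ (R'.plusChart U).ι.appLE ⊤ ⊤ le_top := by
  have hτ := plusChartFac_comp_toA1 R' U φ hφ
  rw [Scheme.Hom.appIso_hom', Scheme.Hom.appLE_comp_appLE, appLE_congr_hom hτ,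
    ← Scheme.Hom.appLE_comp_appLE _ _ _ ⊤ _ le_top le_top, ← Category.assoc, ← Category.assoc]
  congr 1
  rw [Iso.eq_comp_inv]
  exact DatumToEmbedded.StrictTransform.appLE_top_comp_ΓSpecIso_hom _ _

/-- **Every element of the chart algebra is a section of `B₊` over the image of the chart** — `ρ : ⊕𝒥ₙ(U)tⁿ → Γ(B₊, φ ''ᵁ ⊤)`
(`ρ = (ΓSpecIso S)⁻¹ ≫ ι.appLE ⊤ ⊤ ≫ (φ.appIso ⊤)⁻¹`) with `ρ (a·1) = σ₊.appLE a`, `ρ t⁻¹ = tInvOn`, and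
`φ^♯_x (germ_{φ x} (ρ z)) = ι^♯_x (toStalk S (ι x) z)`. [cite: Wlodarczyk2022, Def. 5.1.1] -/
theorem exists_plusChartFac_sections [IsOpenImmersion φ] :
    ∃ ρ : R'.sectionsRing U →+* Γ((R'.plus : Scheme.{0}), φ ''ᵁ ⊤),
      (∀ a : Γ(Y, U), ρ (algebraMap Γ(Y, U) (R'.sectionsRing U) a) =
        R'.πPlus.appLE U (φ ''ᵁ ⊤) (image_top_le_of_plusChartFac R' U φ hφ) a) ∧
      ρ ⟨T (-1), (R'.filtration U).T_neg_one_mem_extendedRees⟩ = tInvOn R' (φ ''ᵁ ⊤) ∧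
      ∀ (x : (R'.plusChart U : Scheme.{0})) (hx : φ x ∈ φ ''ᵁ ⊤) (z : R'.sectionsRing U),
        φ.stalkMap x ((R'.plus : Scheme.{0}).presheaf.germ (φ ''ᵁ ⊤) (φ x) hx (ρ z)) =
          (R'.plusChart U).ι.stalkMap x (StructureSheaf.toStalk (R'.sectionsRing U) ((R'.plusChart U).ι x) z) := by
  refine ⟨((Scheme.ΓSpecIso (CommRingCat.of (R'.sectionsRing U))).inv ≫ (R'.plusChart U).ι.appLE ⊤ ⊤ le_top ≫
    (φ.appIso ⊤).inv).hom, fun a => ?_, ?_, fun x hx z => ?_⟩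
  · -- structure sections
    have h := πPlus_appLE_comp_appIso_hom R' U φ hφ
    rw [← Iso.eq_comp_inv, Category.assoc, Category.assoc] at h
    exact (congrArg (fun f : Γ(Y, U) ⟶ Γ((R'.plus : Scheme.{0}), φ ''ᵁ ⊤) => f.hom a) h).symm
  · -- `t⁻¹`
    have h := toA1_appLE_comp_appIso_hom R' U φ hφ
    rw [← Iso.eq_comp_inv, Category.assoc, Category.assoc, Category.assoc] at h
    have h' := congrArg (fun f : Γ(Spec (CommRingCat.of (Polynomial ReesFiltration.ZZ.{0})), ⊤) ⟶
      Γ((R'.plus : Scheme.{0}), φ ''ᵁ ⊤) =>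
        f.hom ((Scheme.ΓSpecIso (CommRingCat.of (Polynomial ReesFiltration.ZZ.{0}))).inv Polynomial.X)) h
    -- `h'` : `tInvOn = ρ (x ↦ t⁻¹ applied to X)`; read `X ↦ t⁻¹`
    simp only [CommRingCat.hom_comp, RingHom.coe_comp, Function.comp_apply, Iso.inv_hom_id_apply,
      CommRingCat.hom_ofHom, ReesFiltration.polyToSections_X] at h'
    simp only [CommRingCat.hom_comp, RingHom.coe_comp, Function.comp_apply]
    exact h'.symm
  · -- germs read on the chart: `φ^♯ (germ (appIso⁻¹ w)) = germ_x w`, `w = ι^* c` (restricted), `germ_x (ι^* c) = ι^♯ (germ c) = ι^♯ (toStalk (ι x) z)`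
    simp only [CommRingCat.hom_comp, RingHom.coe_comp, Function.comp_apply]
    have e1 := Scheme.Hom.germ_stalkMap_apply φ (φ ''ᵁ ⊤) x hx
      ((φ.appIso ⊤).inv (((R'.plusChart U).ι.appLE ⊤ ⊤ le_top)
        ((Scheme.ΓSpecIso (CommRingCat.of (R'.sectionsRing U))).inv z)))
    have e2 := Scheme.Hom.appIso_inv_app_apply φ ⊤
      (((R'.plusChart U).ι.appLE ⊤ ⊤ le_top) ((Scheme.ΓSpecIso (CommRingCat.of (R'.sectionsRing U))).inv z))
    have e4 := TopCat.Presheaf.germ_res_apply' (R'.plusChart U : Scheme.{0}).presheaf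
      (eqToHom (Scheme.Hom.preimage_image_eq φ ⊤)).op x hx
      (((R'.plusChart U).ι.appLE ⊤ ⊤ le_top) ((Scheme.ΓSpecIso (CommRingCat.of (R'.sectionsRing U))).inv z))
    have e3 : ((R'.plusChart U).ι.appLE ⊤ ⊤ le_top) ((Scheme.ΓSpecIso (CommRingCat.of (R'.sectionsRing U))).inv z) =
        (R'.plusChart U : Scheme.{0}).presheaf.map (homOfLE (le_top : (⊤ : (R'.plusChart U : Scheme.{0}).Opens) ≤
          (R'.plusChart U).ι ⁻¹ᵁ ⊤)).op
          ((R'.plusChart U).ι.app ⊤ ((Scheme.ΓSpecIso (CommRingCat.of (R'.sectionsRing U))).inv z)) := rfl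
    have e4' := TopCat.Presheaf.germ_res_apply' (R'.plusChart U : Scheme.{0}).presheaf
      (homOfLE (le_top : (⊤ : (R'.plusChart U : Scheme.{0}).Opens) ≤ (R'.plusChart U).ι ⁻¹ᵁ ⊤)).op x trivial
      ((R'.plusChart U).ι.app ⊤ ((Scheme.ΓSpecIso (CommRingCat.of (R'.sectionsRing U))).inv z))
    have e5 := (Scheme.Hom.germ_stalkMap_apply (R'.plusChart U).ι ⊤ x trivial
      ((Scheme.ΓSpecIso (CommRingCat.of (R'.sectionsRing U))).inv z)).symm
    have e6 := StructureSheaf.algebraMap_germ_apply (R := R'.sectionsRing U) ⊤ ((R'.plusChart U).ι x) trivial z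
    refine e1.trans (((congrArg (fun t => (R'.plusChart U : Scheme.{0}).presheaf.germ (φ ⁻¹ᵁ φ ''ᵁ ⊤) x hx t) e2).trans
      e4).trans ?_)
    refine ((congrArg (fun t => (R'.plusChart U : Scheme.{0}).presheaf.germ ⊤ x trivial t) e3).trans e4').trans ?_
    exact e5.trans (congrArg (fun t => (R'.plusChart U).ι.stalkMap x t) e6)

/-- Restricting the sections of `exists_plusChartFac_sections` to an open `W' ≤ φ ''ᵁ ⊤`: the same three facts for
`ρ_{W'} := (restriction) ∘ ρ`. [cite: Wlodarczyk2022, Def. 5.1.1] -/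
theorem exists_plusChartFac_sections_restrict [IsOpenImmersion φ] (W' : (R'.plus : Scheme.{0}).Opens)
    (hW' : W' ≤ φ ''ᵁ ⊤) :
    ∃ ρ : R'.sectionsRing U →+* Γ((R'.plus : Scheme.{0}), W'),
      (∀ a : Γ(Y, U), ρ (algebraMap Γ(Y, U) (R'.sectionsRing U) a) =
        R'.πPlus.appLE U W' (hW'.trans (image_top_le_of_plusChartFac R' U φ hφ)) a) ∧
      ρ ⟨T (-1), (R'.filtration U).T_neg_one_mem_extendedRees⟩ = tInvOn R' W' ∧
      ∀ (x : (R'.plusChart U : Scheme.{0})) (hx : φ x ∈ W') (z : R'.sectionsRing U),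
        φ.stalkMap x ((R'.plus : Scheme.{0}).presheaf.germ W' (φ x) hx (ρ z)) =
          (R'.plusChart U).ι.stalkMap x (StructureSheaf.toStalk (R'.sectionsRing U) ((R'.plusChart U).ι x) z) := by
  have h0 := exists_plusChartFac_sections R' U φ hφ
  obtain ⟨ρ, hρa, hρT, hρg⟩ := h0
  refine ⟨((R'.plus : Scheme.{0}).presheaf.map (homOfLE hW').op).hom.comp ρ, fun a => ?_, ?_, fun x hx z => ?_⟩
  · rw [RingHom.comp_apply, hρa]
    exact DatumToEmbedded.AtlasAmbient.map_appLE U R'.πPlus _ _ hW' _ a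
  · rw [RingHom.comp_apply, hρT]
    exact stub_qs_tInvOn_map R' hW'
  · rw [RingHom.comp_apply, TopCat.Presheaf.germ_res_apply]
    exact hρg x (hW' hx) z

end Chart

end Summit.ResolutionOfSingularities.ResolutionOfSingularities.Cruxes.HypersurfaceCentreConstruction.LocalEngine

end
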